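import Mathlib
import Literature.AlgebraicGeometry.Motives.VarietiesRegularProofs

/-!
# A quadratic étale cover of a regular ring is regular: `R[T]/(T² − ν)` for units `ν` and `2`

(crux stmt-ResolutionOfSingularities-15640 `WildQuotients.WildQuotientResolution`, line `Sketch`,
sector `|G| = p`; generic infrastructure for the V4U `μ₂`-point of `L/w45c/CHAIN.md` v5/v6 (stub-4
FINDING V4U-μ₂-POINT 2026-08-27T03:2xZ: the twisted double cover `W[√ν]`; stub-3's V4U-EXIT-NOTE;
LIN-hBR chart b's étale square roots). [OURS · L1 W4.5c] — NOT a statement of any manuscript;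
replaces the role of no printed item. Prover res-L1-w45c-stub-4.)

* `isRegularRing_adjoinRoot_X_sq_sub_C` — for a regular ring `R` (Mathlib `IsRegularRing`) and
  units `ν, 2 ∈ Rˣ`, the free quadratic algebra `R[T]/(T² − ν)` is a regular ring: it is standard
  étale over `R` (Mathlib `StandardEtalePair` with `f = T² − ν`, `g = 2T`, and `g` is already a unit
  in `R[T]/(f)` since `T² = ν`), and étale over regular is regular prime by prime
  (`Literature.AlgebraicGeometry.Motives.IsRegularLocalRing.of_etale`, Stacks 00TV).
-/

-- single-problem summit: the doubled namespace component `ResolutionOfSingularities` is forced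
set_option linter.dupNamespace false

noncomputable section

open Polynomial

namespace Summit.ResolutionOfSingularities.ResolutionOfSingularities.Theorems.WildQuotientResolution.EtaleCover

universe u

/-- **`R[T]/(T² − ν)` is a regular ring** for `R` regular and `ν`, `2` units of `R` (a quadratic
étale cover of a regular ring is regular). [cite: StacksProject, Tag 00TV] [folklore] -/
theorem isRegularRing_adjoinRoot_X_sq_sub_C (R : Type u) [CommRing R] [IsRegularRing R] (ν : R)
    (hν : IsUnit ν) (h2 : IsUnit (2 : R)) :
    IsRegularRing (AdjoinRoot (X ^ 2 - C ν : R[X])) := by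
  set f : R[X] := X ^ 2 - C ν with hf_def
  have hf : f.Monic := monic_X_pow_sub_C ν two_ne_zero
  -- the standard étale pair `(f, 2T)`
  let P : StandardEtalePair R :=
    { f := f
      monic_f := hf
      g := C 2 * X
      cond := ⟨1, 0, 1, by rw [hf_def, derivative_sub, derivative_X_sq, derivative_C]; ring⟩ }
  -- `g = 2T` is a unit of `B = R[T]/(f)` (`T² = ν`)
  have hroot : AdjoinRoot.root f ^ 2 = algebraMap R (AdjoinRoot f) ν := by
    have h := AdjoinRoot.aeval_eq (f := f) f
    rw [AdjoinRoot.mk_self] at h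
    rw [hf_def, map_sub, map_pow, aeval_X, aeval_C, sub_eq_zero] at h
    rw [← hf_def] at h
    exact h
  have hr : IsUnit (AdjoinRoot.root f) :=
    (isUnit_pow_iff two_ne_zero).1 (hroot ▸ hν.map (algebraMap R (AdjoinRoot f)))
  have hunit : IsUnit (AdjoinRoot.mk f (C 2 * X)) := by
    rw [map_mul, AdjoinRoot.mk_C, AdjoinRoot.mk_X]
    exact (h2.map (AdjoinRoot.of f)).mul hr
  have H : Submonoid.powers (AdjoinRoot.mk f (C 2 * X)) ≤ IsUnit.submonoid (AdjoinRoot f) :=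
    Submonoid.powers_le.2 hunit
  -- `B ≃ B[1/g]` and `P.Ring ≃ B[1/g]`, hence `B` is étale over `R`
  let e2 : AdjoinRoot f ≃ₐ[AdjoinRoot f] Localization.Away (AdjoinRoot.mk f (C 2 * X)) :=
    IsLocalization.atUnits (AdjoinRoot f) (Submonoid.powers (AdjoinRoot.mk f (C 2 * X))) H
  let e : P.Ring ≃ₐ[R] AdjoinRoot f := P.equivAwayAdjoinRoot.trans (e2.restrictScalars R).symm
  haveI : Algebra.Etale R (AdjoinRoot f) := Algebra.Etale.of_equiv e
  haveI : IsNoetherianRing (AdjoinRoot f) := Algebra.FiniteType.isNoetherianRing R (AdjoinRoot f)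
  exact
    { isRegularLocalRing_localization := fun p _ =>
        Literature.AlgebraicGeometry.Motives.IsRegularLocalRing.of_etale (R := R) p }

end Summit.ResolutionOfSingularities.ResolutionOfSingularities.Theorems.WildQuotientResolution.EtaleCover

end
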